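import Literature.NumberTheory.PAdicHodge.KummerFilZeroCoboundaryRamifiedOfWeil
import HarnessLib

/-!
# K1 over the ramified base along the CANONICAL matching `T_pE(F̄) ≅ T_pŴ♭(𝒪_{ℂ_F})` of a good `𝒪_F`-model with supersingular reduction

Topic `Literature/NumberTheory/PAdicHodge`; namespace `Literature.NumberTheory.PAdicHodge`. THEOREMS ONLY (no definition, no named fact, no
instance, no `sorry`). The `curveFO`-currency twin of `KummerFilZeroCoboundarySupersingular.isFilZeroCoboundary_kummerCocycle_curveF` (case `W/ℤ`,
matching `tateGeomEquivTatePtSS`) and the concrete companion of `KummerFilZeroCoboundaryRamifiedOfWeil` (same statement along an ABSTRACT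
matching `e : T_pW₀ ≃ T_pŴ♭`): for `W` over `CoeffDisc D = 𝒪_D`, a bridge `ψ : 𝒪_D → 𝒪_F`, `W♭ = W ⊗_ψ 𝒪_F` with good supersingular reduction
at the odd residue characteristic `p` (`Δ ∈ 𝒪_F^×`, `A_p = 0`), `E = curveFO F W♭`, and the tree's canonical matching
`e = AinfTop.tateGeomEquivTatePtOSS F W♭ p` (`AinfWeierstrassTateModuleGeomO`):

* ★ **`isFilZeroCoboundary_kummerCocycleO_curveFO`** — given (N1′) `∫_τ ω ≠ 0` and (Nη) `∫_τ η ∉ Fil¹` for some Tate-module points and a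
  `[p]_W`-division sequence `u` with a `Γ_F`-fixed lift `Q ∈ Ŵ(𝔫_𝒪)` of `u₀`, the Kummer cocycle `σ ↦ 1 ⊗ e⁻¹(κ_u σ)` is a `Fil⁰`-coboundary of
  `B_dR(F) ⊗ V_pE` (`rationalTateRep E p`): integrating pair `AinfRamTop.bOmega / bEta`, basis-free criterion
  `isFilZeroCoboundary_rationalTateModule_of_periodHoms`, Hodge–Tate witness from the Weil determinant
  (`exists_not_mem_fil_two_rationalTateModule_of_periodHoms` with `det_rationalTateRep_eq_cyclotomicCharacter`).

Crux K★ `stmt-BirchSwinnertonDyer-22226`, hT₂ programme brick K1 (the concrete form needed to read the cocycle in the Kummer theory of `E`).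
BSD / K★ are not proved by any of this.

## References
* [BlochKato1990] S. Bloch, K. Kato (1990), Ex. 3.10.1, (3.11.1), Lemma 3.8.1.
* [Tate1967] J. Tate, *p-divisible groups* (1967), §4 Cor. 2.
* [Kato1993LNM1553] K. Kato, LNM 1553 (1993), Ch. II Lemma 1.4.3.
-/

noncomputable section

open scoped TensorProduct

namespace Literature.NumberTheory.PAdicHodge

open Literature Literature.NumberTheory.GaloisRepresentations Literature.NumberTheory.EllipticCurves WeierstrassCurve
open Literature.NumberTheory.GaloisRepresentations.IsNonarchimedeanLocalField Field ValuativeRel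
open Literature.NumberTheory.GaloisRepresentations.LubinTate

variable {F : Type} [Field F] [ValuativeRel F] [TopologicalSpace F] [IsNonarchimedeanLocalField F] [CharZero F]
  {p : ℕ} [Fact p.Prime] [Fact (¬ IsUnit (p : integerC F))] [IsAdicComplete (Ideal.span {(p : integerC F)}) (integerC F)]
  (hp : valuation F p < 1) [Algebra ℚ_[p] F] [CharP 𝓀[F] p]

/-- ★ **K1 along the canonical matching of a good `𝒪_F`-model with supersingular reduction.** `W` over `CoeffDisc D`, `ψ : 𝒪_D → 𝒪_F`
compatible with `𝒪_D → F`, `W♭ = W ⊗_ψ 𝒪_F` with `Δ ∈ 𝒪_F^×` and `A_p(W♭ mod 𝔪_F) = 0` at the odd residue characteristic `p`, `E = curveFO F W♭`,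
`e = tateGeomEquivTatePtOSS`; (N1′) `∫_τ ω ≠ 0` and (Nη) `∫_τ η ∉ Fil¹` for some Tate-module points; `u` a `[p]_W`-division sequence with a
`Γ_F`-fixed lift `Q ∈ Ŵ(𝔫_𝒪)` of `u₀`. Then `σ ↦ 1 ⊗ e⁻¹(κ_u σ)` is a `Fil⁰`-coboundary of `B_dR(F) ⊗ V_pE`.
[cite: BlochKato1990, Ex. 3.10.1, (3.11.1), Lemma 3.8.1] [cite: Tate1967, §4 Cor. 2] [cite: Kato1993LNM1553, Ch. II Lemma 1.4.3] -/
theorem isFilZeroCoboundary_kummerCocycleO_curveFO (D : EisensteinRoot F p hp)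
    (W : WeierstrassCurve (EisensteinRoot.CoeffDisc D)) (ψ : EisensteinRoot.CoeffDisc D →+* LTCoeff F)
    (hψ : ∀ c, algebraMap (LTCoeff F) F (ψ c) = EisensteinRoot.CoeffDisc.toF D c) [(AinfTop.curveFO F (W.map ψ)).IsElliptic]
    (hp2 : p ≠ 2) (hΔ : IsUnit (W.map ψ).Δ) (hA : ((W.map ψ).map (AinfTop.redCoeff F)).hasseCoeff p = 0)
    (hN1 : ∃ τ : AinfTop.TatePtO F (W.map ψ) p, AinfRamTop.omegaPeriodHomO W ψ (surjective_fontaineTheta_integerC hp) hψ τ ≠ 0)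
    (hNη : ∃ τ : AinfTop.TatePtO F (W.map ψ) p,
      AinfRamTop.etaPeriodHomO W ψ (surjective_fontaineTheta_integerC hp) hψ τ ∉ (BdRPlusTop.filOne F p).toIdeal)
    {u : ℕ → (maxNilIdealC F).toIdeal} (hup : ∀ n, AinfRamTop.mulPC W (u (n + 1)) = u n)
    {Q : W.Pt (AinfRamTop.nilTheta D (surjective_fontaineTheta_integerC hp))}
    (hQ : AinfRamTop.thetaPt W (surjective_fontaineTheta_integerC hp) Q = ⟨u 0⟩)
    (hQσ : ∀ σ : absoluteGaloisGroup F, AinfRamTop.galPtN W (surjective_fontaineTheta_integerC hp) σ Q = Q) :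
    (bdRPeriodRingData (F := F) (p := p) hp).IsFilZeroCoboundary (rationalTateRep (AinfTop.curveFO F (W.map ψ)) p) fun σ =>
      ((1 : (bdRPeriodRingData (F := F) (p := p) hp).B) ⊗ₜ[ℚ_[p]]
        TateModule.toRational p ((AinfTop.tateGeomEquivTatePtOSS F (W.map ψ) p hp2 hΔ hA).symm
          (AinfRamTop.kummerCocycleO W ψ hψ u hup (AinfRamTop.galCBall_base_eq_of_fixedLift W hQ hQσ) σ)) :
        (bdRPeriodRingData (F := F) (p := p) hp).B ⊗[ℚ_[p]] (AinfTop.curveFO F (W.map ψ)).rationalTateModule p) := by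
  have hF := surjective_fontaineTheta_integerC hp
  have hpF : (p : F) ≠ 0 := Nat.cast_ne_zero.mpr (Fact.out : p.Prime).ne_zero
  haveI : Module.Finite ℚ_[p] ((AinfTop.curveFO F (W.map ψ)).rationalTateModule p) :=
    module_finite_rationalTateModule_holds (AinfTop.curveFO F (W.map ψ)) p
  -- rigidity of the `ℚ_p`-algebra structure of `F`
  have halg : ∀ c : ℚ_[p], algebraMap ℚ_[p] F c = LocalField.padicRingHom F p hp c := fun c =>
    RingHom.congr_fun (LocalField.ringHom_padic_ext _ _) c
  -- the matching, the bridge `B_dR⁺ → B_dR`, the two period functionals on `T_pE`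
  let e : (AinfTop.curveFO F (W.map ψ)).tateModule p ≃ₗ[ℤ_[p]] AinfTop.TatePtO F (W.map ψ) p :=
    AinfTop.tateGeomEquivTatePtOSS F (W.map ψ) p hp2 hΔ hA
  let ιB : BdRPlusTop F p →+* (bdRPeriodRingData (F := F) (p := p) hp).B :=
    (algebraMap (BDeRhamPlus (integerC F) p) (FracBdR F p)).comp (BdRPlusTop.of F p).symm.toRingHom
  have hιB : ∀ y, ιB y = algebraMap (BDeRhamPlus (integerC F) p) (FracBdR F p) ((BdRPlusTop.of F p).symm y) :=
    fun _ => rfl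
  let φ₁ : (AinfTop.curveFO F (W.map ψ)).tateModule p →+ (bdRPeriodRingData (F := F) (p := p) hp).B :=
    ιB.toAddMonoidHom.comp ((AinfRamTop.omegaPeriodHomO W ψ hF hψ).comp e.toAddMonoidHom)
  let φ₂ : (AinfTop.curveFO F (W.map ψ)).tateModule p →+ (bdRPeriodRingData (F := F) (p := p) hp).B :=
    ιB.toAddMonoidHom.comp ((AinfRamTop.etaPeriodHomO W ψ hF hψ).comp e.toAddMonoidHom)
  have hφ₁ : ∀ a, φ₁ a = ιB (AinfRamTop.omegaPeriodHomO W ψ hF hψ (e a)) := fun _ => rfl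
  have hφ₂ : ∀ a, φ₂ a = ιB (AinfRamTop.etaPeriodHomO W ψ hF hψ (e a)) := fun _ => rfl
  -- dictionary: scalars, Galois, the matching
  have hsc : ∀ (c : ℤ_[p]) (y : BdRPlusTop F p),
      ιB (BdRPlusTop.of F p (qpToBdR (c : ℚ_[p])) * y) = (c : ℚ_[p]) • ιB y := fun c y => by
    rw [map_mul, Algebra.smul_def, PeriodRingData.algebraMap_eq]
    congr 1
    change algebraMap (BDeRhamPlus (integerC F) p) (FracBdR F p) (qpToBdR (c : ℚ_[p])) =
      algebraMap (BDeRhamPlus (integerC F) p) (FracBdR F p) (embBdRHom hp hF (algebraMap ℚ_[p] F c))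
    rw [embBdRHom_algebraMap_padic hp hF halg]
  have hgal : ∀ (σ : absoluteGaloisGroup F) (y : BdRPlusTop F p), ιB (BdRPlusTop.gal F p σ y) = σ • ιB y := fun σ y => by
    change _ = σ • algebraMap (BDeRhamPlus (integerC F) p) (FracBdR F p) ((BdRPlusTop.of F p).symm y)
    rw [smul_algebraMap_fracBdR]
    rfl
  have he : ∀ (σ : absoluteGaloisGroup F) (a : (AinfTop.curveFO F (W.map ψ)).tateModule p), e (σ • a) = σ • e a := fun σ a =>
    AinfTop.tateGeomEquivTatePtOSS_smul (W.map ψ) hp2 hΔ hA σ a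
  -- the hypotheses of the basis-free criterion
  have h₁ : ∀ (c : ℤ_[p]) (a : (AinfTop.curveFO F (W.map ψ)).tateModule p), φ₁ (c • a) = (c : ℚ_[p]) • φ₁ a := fun c a => by
    rw [hφ₁, hφ₁, LinearEquiv.map_smul, AinfRamTop.omegaPeriodHomO_smul', hsc]
  have h₂ : ∀ (c : ℤ_[p]) (a : (AinfTop.curveFO F (W.map ψ)).tateModule p), φ₂ (c • a) = (c : ℚ_[p]) • φ₂ a := fun c a => by
    rw [hφ₂, hφ₂, LinearEquiv.map_smul, AinfRamTop.etaPeriodHomO_smul', hsc]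
  have h₃ : ∀ (σ : absoluteGaloisGroup F) (a : (AinfTop.curveFO F (W.map ψ)).tateModule p), φ₁ (σ • a) = σ • φ₁ a := fun σ a => by
    rw [hφ₁, hφ₁, he, ← AinfRamTop.gal_omegaPeriodHomO, hgal]
  have h₄ : ∀ (σ : absoluteGaloisGroup F) (a : (AinfTop.curveFO F (W.map ψ)).tateModule p), φ₂ (σ • a) = σ • φ₂ a := fun σ a => by
    rw [hφ₂, hφ₂, he, ← AinfRamTop.gal_etaPeriodHomO, hgal]
  have h₅ : ∀ a, φ₁ a ∈ (bdRPeriodRingData (F := F) (p := p) hp).fil 1 := fun a => by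
    rw [hφ₁, hιB]
    exact (algebraMap_mem_fil_one_iff hp _).2 (AinfRamTop.omegaPeriodHomO_mem_filOne W ψ _)
  have h₆ : ∀ a, φ₂ a ∈ (bdRPeriodRingData (F := F) (p := p) hp).fil 0 := fun a => by
    rw [hφ₂, hιB]
    haveI : IsDomain (BDeRhamPlus (integerC F) p) := isDomain_bDeRhamPlus hF
    letI : Algebra F (FracBdR F p) := fracAlgebra hp hF
    exact algebraMap_mem_fil_zero hp hF _
  have h₇ : ∃ a, φ₁ a ≠ 0 := by
    obtain ⟨τ, hτ⟩ := hN1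
    refine ⟨e.symm τ, fun h0 => hτ ?_⟩
    rw [hφ₁, LinearEquiv.apply_symm_apply, hιB] at h0
    have h1 := algebraMap_fracBdR_injective (F := F) (p := p) (h0.trans (map_zero _).symm)
    exact (BdRPlusTop.of F p).symm.injective (h1.trans (map_zero _).symm)
  have h₈ : ∃ a, φ₂ a ∉ (bdRPeriodRingData (F := F) (p := p) hp).fil 1 := by
    obtain ⟨τ, hτ⟩ := hNη
    refine ⟨e.symm τ, fun h => hτ ((algebraMap_mem_fil_one_iff hp _).1 ?_)⟩
    rwa [hφ₂, LinearEquiv.apply_symm_apply, hιB] at h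
  -- Hodge–Tate nonvanishing from the Weil determinant
  have hne : ∃ a, φ₁ a ∉ (bdRPeriodRingData (F := F) (p := p) hp).fil 2 :=
    exists_not_mem_fil_two_rationalTateModule_of_periodHoms hp (rationalTateRep (AinfTop.curveFO F (W.map ψ)) p)
      (fun σ a => σ • a) (finrank_rationalTateModule_eq_two_holds (AinfTop.curveFO F (W.map ψ)) p hpF) (fun _ _ _ => rfl)
      (det_rationalTateRep_eq_cyclotomicCharacter (F := F) (p := p) (AinfTop.curveFO F (W.map ψ)))
      φ₁ φ₂ h₁ h₂ h₃ h₄ h₅ h₆ h₇ h₈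
  -- the integrating pair
  have hu₀ := AinfRamTop.galCBall_base_eq_of_fixedLift W hQ hQσ
  have hω : ∀ σ, BdRPlusTop.gal F p σ (AinfRamTop.bOmega W hup hQ) - AinfRamTop.bOmega W hup hQ =
      AinfRamTop.omegaPeriodHomO W ψ hF hψ (AinfRamTop.kummerCocycleO W ψ hψ u hup hu₀ σ) :=
    AinfRamTop.gal_bOmega_sub_bOmega_eq_omegaPeriodHomO W ψ hup hQ hQσ
  have hη : ∀ σ, BdRPlusTop.gal F p σ (AinfRamTop.bEta W hup hQ) - AinfRamTop.bEta W hup hQ =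
      AinfRamTop.etaPeriodHomO W ψ hF hψ (AinfRamTop.kummerCocycleO W ψ hψ u hup hu₀ σ) :=
    AinfRamTop.gal_bEta_sub_bEta_eq_etaPeriodHomO W ψ hup hQ hQσ
  -- feed the basis-free criterion
  refine isFilZeroCoboundary_rationalTateModule_of_periodHoms hp (rationalTateRep (AinfTop.curveFO F (W.map ψ)) p)
    (fun σ a => σ • a) (finrank_rationalTateModule_eq_two_holds (AinfTop.curveFO F (W.map ψ)) p hpF) (fun _ _ _ => rfl) φ₁ φ₂
    h₁ h₂ h₃ h₄ h₅ h₆ hne h₈ (fun σ => e.symm (AinfRamTop.kummerCocycleO W ψ hψ u hup hu₀ σ))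
    (b₁ := ιB (AinfRamTop.bOmega W hup hQ)) (b₂ := ιB (AinfRamTop.bEta W hup hQ)) ?_ ?_ (fun σ => ?_) (fun σ => ?_)
  · rw [hιB]
    exact (algebraMap_mem_fil_one_iff hp _).2 (AinfRamTop.bOmega_mem_filOne W hup hQ)
  · rw [hιB]
    haveI : IsDomain (BDeRhamPlus (integerC F) p) := isDomain_bDeRhamPlus hF
    letI : Algebra F (FracBdR F p) := fracAlgebra hp hF
    exact algebraMap_mem_fil_zero hp hF _
  · rw [hφ₁, LinearEquiv.apply_symm_apply, ← hω σ, map_sub, hgal]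
  · rw [hφ₂, LinearEquiv.apply_symm_apply, ← hη σ, map_sub, hgal]

end Literature.NumberTheory.PAdicHodge

end
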